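import Summits.ValiantsHypothesis.ValiantsHypothesis.Theorems.LacunarySymmetroidMatrixDescartesFiniteSectorSectorCeilingSixtyfourFourVA
import Summits.ValiantsHypothesis.ValiantsHypothesis.Theorems.LacunarySymmetroidMatrixDescartesFiniteSectorSectorCeilingSixtyfourFourVB
import Summits.ValiantsHypothesis.ValiantsHypothesis.Theorems.LacunarySymmetroidMatrixDescartesFiniteSectorSectorCeilingSixtyfourFourVC
import Summits.ValiantsHypothesis.ValiantsHypothesis.Theorems.LacunarySymmetroidMatrixDescartesFiniteSectorSectorCeilingSixtyfourFourVH
import Summits.ValiantsHypothesis.ValiantsHypothesis.Theorems.LacunarySymmetroidMatrixDescartesFiniteSectorSectorCeilingSixtyfourFourVI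
import Summits.ValiantsHypothesis.ValiantsHypothesis.Theorems.LacunarySymmetroidMatrixDescartesFiniteSectorSectorCeilingSixtyfourFourVJ
import Summits.ValiantsHypothesis.ValiantsHypothesis.Theorems.LacunarySymmetroidMatrixDescartesFiniteSectorSectorCeilingSixtyfourFourVK
import Summits.ValiantsHypothesis.ValiantsHypothesis.Theorems.LacunarySymmetroidMatrixDescartesFiniteSectorSectorCeilingSixtyfourFourVL
import Summits.ValiantsHypothesis.ValiantsHypothesis.Theorems.LacunarySymmetroidMatrixDescartesFiniteSectorSectorCeilingSixtyfourFourVM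
import Summits.ValiantsHypothesis.ValiantsHypothesis.Theorems.LacunarySymmetroidMatrixDescartesFiniteSectorSectorCeilingSixtyfourFourVN
import Summits.ValiantsHypothesis.ValiantsHypothesis.Theorems.LacunarySymmetroidMatrixDescartesFiniteSectorSectorCeilingSixtyfourFourVO
import Summits.ValiantsHypothesis.ValiantsHypothesis.Theorems.LacunarySymmetroidMatrixDescartesFiniteSectorSectorCeilingSixtyfourFourVP
import Summits.ValiantsHypothesis.ValiantsHypothesis.Theorems.LacunarySymmetroidMatrixDescartesFiniteSectorSectorCeilingSixtyfourFourVQ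
import Summits.ValiantsHypothesis.ValiantsHypothesis.Theorems.LacunarySymmetroidMatrixDescartesFiniteSectorSectorCeilingSixtyfourFourVR
import Summits.ValiantsHypothesis.ValiantsHypothesis.Theorems.LacunarySymmetroidMatrixDescartesFiniteSectorSectorCeilingSixtyfourFourVS
import Summits.ValiantsHypothesis.ValiantsHypothesis.Theorems.LacunarySymmetroidMatrixDescartesFiniteSectorIterMasksWalk
import Summits.ValiantsHypothesis.ValiantsHypothesis.Theorems.LacunarySymmetroidMatrixDescartesFiniteSector

/-!
# `MatrixDescartes` — line «finite»: the SECTOR CEILING `η(64,4) ≤ σ(64,4) = 31676` (kernel) — `HypRootLawAt 64 4 31676`, Conjecture Σ's value `2·n(64,3)`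

HONEST FRAMING.  Object-search cell `pub-symmetroid`, seat val-sym-door-p5 g12.  HELPER of the crux item `stmt-ValiantsHypothesis-18050` (`Theses.LacunarySymmetroid.MatrixDescartes`)
with NO closure claim.  The SIEVE of line «finite» (`FiniteSector.sieve`, `natDegree_mem_sumset`) makes the `64`-fold sums of exponents of an in-sector pencil a
step-≤-2 chain from `0` up to the degree; the finite core — no `3` positive values carry such a chain beyond `31676` — has 239 267 live prefixes and is
decided in the kernel in the WALKER shape of `…FiniteSectorIterMasksWalk` (seat val-sym-door-p5 g12; TWO-LEVEL slices `sectorWalk_sixtyfour_four_s2_*_s3_*` (two-level slicing: seat val-sym-door-p5 g12) in `…FiniteSectorSectorCeilingSixtyfourFourVA`, `…FiniteSectorSectorCeilingSixtyfourFourVB`, `…FiniteSectorSectorCeilingSixtyfourFourVC`, `…FiniteSectorSectorCeilingSixtyfourFourVH`, `…FiniteSectorSectorCeilingSixtyfourFourVI`, `…FiniteSectorSectorCeilingSixtyfourFourVJ`, `…FiniteSectorSectorCeilingSixtyfourFourVK`, `…FiniteSectorSectorCeilingSixtyfourFourVL`, `…FiniteSectorSectorCeilingSixtyfourFourVM`,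 `…FiniteSectorSectorCeilingSixtyfourFourVN`, `…FiniteSectorSectorCeilingSixtyfourFourVO`, `…FiniteSectorSectorCeilingSixtyfourFourVP`, `…FiniteSectorSectorCeilingSixtyfourFourVQ`, `…FiniteSectorSectorCeilingSixtyfourFourVR`, `…FiniteSectorSectorCeilingSixtyfourFourVS`);
the transfer reads the census sum set as capped multisets and peels the walker level by level (`walk_true`).  Result: `hypRootLawAt_sixtyfour_four_31676 : HypRootLawAt 64 4 31676`.
Located first (exact DFS): the chain survives to `31675` only on the doubled extremal basis `2·{0,1,45,690}` — `σ(64,4) = 31676 = 2·n(64,3)`, Conjecture Σ of `Lines/finite.md` at the cell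
`(64,4)`; the lower side needs a realised doubled basis and is NOT claimed here.  Nothing here bears on the crux (asymptotic), on `H3`, on the doors, or on `VP ≠ VNP`.
[folklore] Gap-rule / sieve bookkeeping plus a finite enumeration (postage-stamp numbers `n(64,·)`); no citation is load-bearing.
-/

-- `Summit.ValiantsHypothesis.ValiantsHypothesis.…` repeats a component by the D-0017 layout
-- (single-conjunct summit), which the `dupNamespace` linter flags; the name is mandated.
set_option linter.dupNamespace false

namespace Summit.ValiantsHypothesis.ValiantsHypothesis.Theorems.LacunarySymmetroidMatrixDescartes.FiniteSector

open scoped BigOperators Matrix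
open Polynomial

/-! ## `(64,4)`: `σ(64,4) = 31676` -/

set_option maxHeartbeats 4000000 in
set_option maxRecDepth 100000 in
/-- **`η(64,4) ≤ 31676 = σ(64,4)`** — `HypRootLawAt 64 4 31676`: every in-sector (`#distinct real roots = natDegree`) determinant of a real symmetric
`64 × 64` lacunary pencil with `4` terms has degree `≤ 31676` (SIEVE ⇒ step-≤-2 chain of `64`-fold sums; values capped at `31679`, padded, sorted; capped
multisets; the kernel walker slices, peeled level by level with `walk_true`). [folklore] -/
theorem hypRootLawAt_sixtyfour_four_31676 : HypRootLawAt 64 4 31676 := by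
  intro d S hS hsec
  by_contra hdeg'
  have hdeg : 31676 < (pencil d S).det.natDegree := not_le.mp hdeg'
  have hq : (pencil d S).det ≠ 0 := by
    intro h0; rw [h0] at hdeg; simp at hdeg
  have hchain0 : ∀ r, r + 2 ≤ (pencil d S).det.natDegree →
      r ∈ (Finset.univ : Finset (Sym (Fin 4) 64)).image (fun s : Sym (Fin 4) 64 => ((s : Multiset (Fin 4)).map d).sum) ∨
      r + 1 ∈ (Finset.univ : Finset (Sym (Fin 4) 64)).image (fun s : Sym (Fin 4) 64 => ((s : Multiset (Fin 4)).map d).sum) :=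
    fun r hr => sieve d S hq hsec hr
  have htop0 := natDegree_mem_sumset d S hq
  set cv : Fin 4 → ℕ := fun i => min (d i) 31679 with hcv
  have hcvle : ∀ i, cv i ≤ 31679 := fun i => Nat.min_le_right _ _
  set V : Finset ℕ := Finset.univ.image cv with hV
  have hcvV : ∀ i, cv i ∈ V := fun i => Finset.mem_image_of_mem cv (Finset.mem_univ i)
  have h0V : 0 ∈ V := by
    have key : ∃ i : Fin 4, d i = 0 := by
      rcases hchain0 0 (by omega) with h | h
      · obtain ⟨i, hi⟩ := exists_index_eq_zero d 31679 (by norm_num) (by norm_num) h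
        refine ⟨i, ?_⟩
        rcases Nat.lt_or_ge (d i) 31679 with hlt | hge
        · rwa [Nat.min_eq_left hlt.le] at hi
        · rw [Nat.min_eq_right hge] at hi
          omega
      · obtain ⟨t, ht, hcard, hsum⟩ := exists_multiset_of_mem_sumset d 31679 ((List.finRange 4).map (fun i => min (d i) 31679))
          (fun i => List.mem_map.mpr ⟨i, List.mem_finRange i, rfl⟩) (by norm_num) h
        have hex : ∃ x ∈ t, x = 0 := by
          by_contra hall; push Not at hall; have h1 : ∀ x ∈ t, 1 ≤ x := fun x hx => Nat.one_le_iff_ne_zero.mpr (hall x hx); have := Multiset.card_nsmul_le_sum h1; rw [hcard] at this; simp at this; omega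
        obtain ⟨x, hx, hx0⟩ := hex
        obtain ⟨j, -, hj⟩ := List.mem_map.mp (ht x hx)
        refine ⟨j, ?_⟩
        have := hj.trans hx0
        rcases Nat.lt_or_ge (d j) 31679 with hlt | hge
        · rwa [Nat.min_eq_left hlt.le] at this
        · rw [Nat.min_eq_right hge] at this
          omega
    obtain ⟨i, hi⟩ := key
    have : cv i = 0 := by simp [hcv, hi]
    exact this ▸ hcvV i
  set W : Finset ℕ := V.erase 0 with hW
  have hWsub : W ⊆ (Finset.range 31680).erase 0 := by
    intro u hu; rw [hW, Finset.mem_erase] at hu; obtain ⟨hu0, huV⟩ := hu; rw [hV, Finset.mem_image] at huV; obtain ⟨i, -, rfl⟩ := huV; rw [Finset.mem_erase, Finset.mem_range]; exact ⟨hu0, Nat.lt_succ_of_le (hcvle i)⟩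
  have hWcard : W.card ≤ 3 := by
    have hVK : V.card ≤ 4 := by
      have := Finset.card_image_le (s := (Finset.univ : Finset (Fin 4))) (f := cv); simpa using this
    have h1 : W.card + 1 = V.card := by rw [hW]; exact Finset.card_erase_add_one h0V
    omega
  obtain ⟨W', hWW', hW'sub, hW'card⟩ := Finset.exists_subsuperset_card_eq hWsub hWcard
    (by rw [Finset.card_erase_of_mem (by simp), Finset.card_range]; omega)
  have hVW' : ∀ u ∈ V, u = 0 ∨ u ∈ W' := by
    intro u hu
    by_cases hu0 : u = 0
    · exact Or.inl hu0
    · exact Or.inr (hWW' (by rw [hW, Finset.mem_erase]; exact ⟨hu0, hu⟩))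
  have hlmem : ∀ u, u ∈ Finset.sort W' ↔ u ∈ W' := fun u => Finset.mem_sort _
  have hlsort : (Finset.sort W').SortedLT := Finset.sortedLT_sort W'
  have hllen : (Finset.sort W').length = 3 := by rw [Finset.length_sort, hW'card]
  generalize hl : Finset.sort W' = l at hlmem hlsort hllen
  rcases l with _ | ⟨a, _ | ⟨b, _ | ⟨c, _ | ⟨zz, ll⟩⟩⟩⟩
  all_goals simp only [List.length_cons, List.length_nil] at hllen
  all_goals try omega
  have hltC : ∀ u, u ∈ [a, b, c] → u < 31680 := by
    intro u hu; have hu' : u ∈ W' := (hlmem u).mp hu; have := hW'sub hu'; rw [Finset.mem_erase, Finset.mem_range] at this; exact this.2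
  have hgt : ∀ u, u ∈ [a, b, c] → 0 < u := by
    intro u hu; have hu' : u ∈ W' := (hlmem u).mp hu; have := hW'sub hu'; rw [Finset.mem_erase] at this; omega
  have hlt0 : 0 < a := hgt a (by simp)
  have hin : ∀ u ∈ V, u ∈ [0, a, b, c] := by
    intro u hu
    rcases hVW' u hu with h | h
    · rw [h]; simp
    · exact List.mem_cons_of_mem _ ((hlmem u).mpr h)
  have hL : ∀ i, min (d i) 31679 ∈ [0, a, b, c] := fun i => by
    have := hin _ (hcvV i)
    simpa only [hcv] using this
  have hsumP : ∀ r, r ≤ 31678 →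
      r ∈ (Finset.univ : Finset (Sym (Fin 4) 64)).image (fun s : Sym (Fin 4) 64 => ((s : Multiset (Fin 4)).map d).sum) →
      ∃ t : Multiset ℕ, (∀ x ∈ t, x ∈ [0, a, b, c]) ∧ Multiset.card t = 64 ∧ t.sum = r := by
    intro r hr hr'
    have key := exists_multiset_of_mem_sumset d 31679 [0, a, b, c] hL (Nat.lt_succ_of_le hr) hr'
    exact key
  have hchainP : ∀ r, r ≤ 31675 → (∃ t : Multiset ℕ, (∀ x ∈ t, x ∈ [0, a, b, c]) ∧ Multiset.card t = 64 ∧ t.sum = r) ∨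
      (∃ t : Multiset ℕ, (∀ x ∈ t, x ∈ [0, a, b, c]) ∧ Multiset.card t = 64 ∧ t.sum = r + 1) := by
    intro r hr
    rcases hchain0 r (by omega) with h | h
    · exact Or.inl (hsumP r (by omega) h)
    · exact Or.inr (hsumP (r + 1) (by omega) h)
  have hlt1 : a < b := by
    have := hlsort (show (⟨0, by simp⟩ : Fin [a, b, c].length) < ⟨1, by simp⟩ from Fin.mk_lt_mk.mpr (by norm_num)); simpa using this
  have hlt2 : b < c := by
    have := hlsort (show (⟨1, by simp⟩ : Fin [a, b, c].length) < ⟨2, by simp⟩ from Fin.mk_lt_mk.mpr (by norm_num)); simpa using this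
  have hC0 : a < 31680 := hltC a (by simp)
  have hC1 : b < 31680 := hltC b (by simp)
  have hC2 : c < 31680 := hltC c (by simp)
  have hrest0 : ∀ y ∈ [a, b, c], a ≤ y := by
    intro y hy; simp only [List.mem_cons, List.mem_nil_iff, or_false] at hy; omega
  have halive0 : ∀ r < min 31676 (a - 1), ((@Nat.rec (fun _ => ℕ) ((fun (E : ℕ) => @List.rec ℕ (fun _ => ℕ) 0 (fun (x : ℕ) (_ : List ℕ) (acc : ℕ) => Nat.lor acc (Nat.shiftLeft E x)) [0]) 1) (fun (_ acc : ℕ) => (fun (E : ℕ) => @List.rec ℕ (fun _ => ℕ) 0 (fun (x : ℕ) (_ : List ℕ) (acc : ℕ) => Nat.lor acc (Nat.shiftLeft E x)) [0]) acc) 63)).testBit r = true ∨ ((@Nat.rec (fun _ => ℕ) ((fun (E : ℕ) => @List.rec ℕ (fun _ => ℕ) 0 (fun (x : ℕ) (_ : List ℕ) (acc : ℕ) => Nat.lor acc (Nat.shiftLeft E x)) [0]) 1) (fun (_ acc : ℕ) => (fun (E : ℕ) => @List.rec ℕ (fun _ => ℕ) 0 (fun (x : ℕ) (_ : List ℕ)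 (acc : ℕ) => Nat.lor acc (Nat.shiftLeft E x)) [0]) acc) 63)).testBit (r + 1) = true := by
    intro r hr
    rcases hchainP r (by omega) with ⟨t, ht, hcard, hsum⟩ | ⟨t, ht, hcard, hsum⟩
    · have ht' := multiset_prefix (l₁ := [0]) (l₂ := [a, b, c]) hrest0 (by omega) ht
      rw [← hsum]
      exact Or.inl (testBit_lagMask_of_multiset [0] 63 t ht' hcard)
    · have ht' := multiset_prefix (l₁ := [0]) (l₂ := [a, b, c]) hrest0 (by omega) ht
      rw [← hsum]
      exact Or.inr (testBit_lagMask_of_multiset [0] 63 t ht' hcard)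
  have hz0 : ((@Nat.rec (fun _ => ℕ) ((fun (E : ℕ) => @List.rec ℕ (fun _ => ℕ) 0 (fun (x : ℕ) (_ : List ℕ) (acc : ℕ) => Nat.lor acc (Nat.shiftLeft E x)) [0]) 1) (fun (_ acc : ℕ) => (fun (E : ℕ) => @List.rec ℕ (fun _ => ℕ) 0 (fun (x : ℕ) (_ : List ℕ) (acc : ℕ) => Nat.lor acc (Nat.shiftLeft E x)) [0]) acc) 63)).testBit 0 = true := testBit_lagMask_zero [0] 63 (by simp)
  have hg0 := alive_guards (Mp := (@Nat.rec (fun _ => ℕ) ((fun (E : ℕ) => @List.rec ℕ (fun _ => ℕ) 0 (fun (x : ℕ) (_ : List ℕ) (acc : ℕ) => Nat.lor acc (Nat.shiftLeft E x)) [0]) 1) (fun (_ acc : ℕ) => (fun (E : ℕ) => @List.rec ℕ (fun _ => ℕ) 0 (fun (x : ℕ) (_ : List ℕ) (acc : ℕ) => Nat.lor acc (Nat.shiftLeft E x)) [0]) acc) 63)) (lo := 0) (T := 31676) (c := a) hz0 halive0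
  have hrest1 : ∀ y ∈ [b, c], b ≤ y := by
    intro y hy; simp only [List.mem_cons, List.mem_nil_iff, or_false] at hy; omega
  have halive1 : ∀ r < min 31676 (b - 1), ((@Nat.rec (fun _ => ℕ) ((fun (E : ℕ) => @List.rec ℕ (fun _ => ℕ) 0 (fun (x : ℕ) (_ : List ℕ) (acc : ℕ) => Nat.lor acc (Nat.shiftLeft E x)) [0, a]) 1) (fun (_ acc : ℕ) => (fun (E : ℕ) => @List.rec ℕ (fun _ => ℕ) 0 (fun (x : ℕ) (_ : List ℕ) (acc : ℕ) => Nat.lor acc (Nat.shiftLeft E x)) [0, a]) acc) 63)).testBit r = true ∨ ((@Nat.rec (fun _ => ℕ) ((fun (E : ℕ) => @List.rec ℕ (fun _ => ℕ) 0 (fun (x : ℕ) (_ : List ℕ) (acc : ℕ) => Nat.lor acc (Nat.shiftLeft E x)) [0, a]) 1) (fun (_ acc : ℕ) => (fun (E : ℕ) => @List.rec ℕ (fun _ => ℕ) 0 (fun (x : ℕ) (_ : List ℕ) (acc : ℕ) => Nat.lor acc (Nat.shiftLeft E x)) [0, a]) acc) 63)).testBit (r + 1) = true := by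
    intro r hr
    rcases hchainP r (by omega) with ⟨t, ht, hcard, hsum⟩ | ⟨t, ht, hcard, hsum⟩
    · have ht' := multiset_prefix (l₁ := [0, a]) (l₂ := [b, c]) hrest1 (by omega) ht
      rw [← hsum]
      exact Or.inl (testBit_lagMask_of_multiset [0, a] 63 t ht' hcard)
    · have ht' := multiset_prefix (l₁ := [0, a]) (l₂ := [b, c]) hrest1 (by omega) ht
      rw [← hsum]
      exact Or.inr (testBit_lagMask_of_multiset [0, a] 63 t ht' hcard)
  have hz1 : ((@Nat.rec (fun _ => ℕ) ((fun (E : ℕ) => @List.rec ℕ (fun _ => ℕ) 0 (fun (x : ℕ) (_ : List ℕ) (acc : ℕ) => Nat.lor acc (Nat.shiftLeft E x)) [0, a]) 1) (fun (_ acc : ℕ) => (fun (E : ℕ) => @List.rec ℕ (fun _ => ℕ) 0 (fun (x : ℕ) (_ : List ℕ) (acc : ℕ) => Nat.lor acc (Nat.shiftLeft E x)) [0, a]) acc) 63)).testBit 0 = true := testBit_lagMask_zero [0, a] 63 (by simp)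
  have hg1 := alive_guards (Mp := (@Nat.rec (fun _ => ℕ) ((fun (E : ℕ) => @List.rec ℕ (fun _ => ℕ) 0 (fun (x : ℕ) (_ : List ℕ) (acc : ℕ) => Nat.lor acc (Nat.shiftLeft E x)) [0, a]) 1) (fun (_ acc : ℕ) => (fun (E : ℕ) => @List.rec ℕ (fun _ => ℕ) 0 (fun (x : ℕ) (_ : List ℕ) (acc : ℕ) => Nat.lor acc (Nat.shiftLeft E x)) [0, a]) acc) 63)) (lo := a) (T := 31676) (c := b) hz1 halive1
  have hrest2 : ∀ y ∈ [c], c ≤ y := by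
    intro y hy; simp only [List.mem_cons, List.mem_nil_iff, or_false] at hy; omega
  have halive2 : ∀ r < min 31676 (c - 1), ((@Nat.rec (fun _ => ℕ) ((fun (E : ℕ) => @List.rec ℕ (fun _ => ℕ) 0 (fun (x : ℕ) (_ : List ℕ) (acc : ℕ) => Nat.lor acc (Nat.shiftLeft E x)) [0, a, b]) 1) (fun (_ acc : ℕ) => (fun (E : ℕ) => @List.rec ℕ (fun _ => ℕ) 0 (fun (x : ℕ) (_ : List ℕ) (acc : ℕ) => Nat.lor acc (Nat.shiftLeft E x)) [0, a, b]) acc) 63)).testBit r = true ∨ ((@Nat.rec (fun _ => ℕ) ((fun (E : ℕ) => @List.rec ℕ (fun _ => ℕ) 0 (fun (x : ℕ) (_ : List ℕ) (acc : ℕ) => Nat.lor acc (Nat.shiftLeft E x)) [0, a, b]) 1) (fun (_ acc : ℕ) => (fun (E : ℕ) => @List.rec ℕ (fun _ => ℕ) 0 (fun (x : ℕ) (_ : List ℕ) (acc : ℕ) => Nat.lor acc (Nat.shiftLeft E x)) [0, a, b]) acc) 63)).testBit (r + 1) = true := by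
    intro r hr
    rcases hchainP r (by omega) with ⟨t, ht, hcard, hsum⟩ | ⟨t, ht, hcard, hsum⟩
    · have ht' := multiset_prefix (l₁ := [0, a, b]) (l₂ := [c]) hrest2 (by omega) ht
      rw [← hsum]
      exact Or.inl (testBit_lagMask_of_multiset [0, a, b] 63 t ht' hcard)
    · have ht' := multiset_prefix (l₁ := [0, a, b]) (l₂ := [c]) hrest2 (by omega) ht
      rw [← hsum]
      exact Or.inr (testBit_lagMask_of_multiset [0, a, b] 63 t ht' hcard)
  have hz2 : ((@Nat.rec (fun _ => ℕ) ((fun (E : ℕ) => @List.rec ℕ (fun _ => ℕ) 0 (fun (x : ℕ) (_ : List ℕ) (acc : ℕ) => Nat.lor acc (Nat.shiftLeft E x)) [0, a, b]) 1) (fun (_ acc : ℕ) => (fun (E : ℕ) => @List.rec ℕ (fun _ => ℕ) 0 (fun (x : ℕ) (_ : List ℕ) (acc : ℕ) => Nat.lor acc (Nat.shiftLeft E x)) [0, a, b]) acc) 63)).testBit 0 = true := testBit_lagMask_zero [0, a, b] 63 (by simp)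
  have hg2 := alive_guards (Mp := (@Nat.rec (fun _ => ℕ) ((fun (E : ℕ) => @List.rec ℕ (fun _ => ℕ) 0 (fun (x : ℕ) (_ : List ℕ) (acc : ℕ) => Nat.lor acc (Nat.shiftLeft E x)) [0, a, b]) 1) (fun (_ acc : ℕ) => (fun (E : ℕ) => @List.rec ℕ (fun _ => ℕ) 0 (fun (x : ℕ) (_ : List ℕ) (acc : ℕ) => Nat.lor acc (Nat.shiftLeft E x)) [0, a, b]) acc) 63)) (lo := b) (T := 31676) (c := c) hz2 halive2
  have hleafA : Nat.beq (Nat.mod (Nat.lor (@Nat.rec (fun _ => ℕ) 1 (fun (k acc : ℕ) => Nat.lor (@Nat.rec (fun _ => ℕ) ((fun (E : ℕ) => @List.rec ℕ (fun _ => ℕ) 0 (fun (x : ℕ) (_ : List ℕ) (acc : ℕ) => Nat.lor acc (Nat.shiftLeft E x)) [0, a, b]) 1) (fun (_ acc : ℕ) => (fun (E : ℕ) => @List.rec ℕ (fun _ => ℕ) 0 (fun (x : ℕ) (_ : List ℕ) (acc : ℕ) => Nat.lor acc (Nat.shiftLeft E x)) [0, a, b]) acc) k) (Nat.shiftLeft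 acc c)) 64) (Nat.div (@Nat.rec (fun _ => ℕ) 1 (fun (k acc : ℕ) => Nat.lor (@Nat.rec (fun _ => ℕ) ((fun (E : ℕ) => @List.rec ℕ (fun _ => ℕ) 0 (fun (x : ℕ) (_ : List ℕ) (acc : ℕ) => Nat.lor acc (Nat.shiftLeft E x)) [0, a, b]) 1) (fun (_ acc : ℕ) => (fun (E : ℕ) => @List.rec ℕ (fun _ => ℕ) 0 (fun (x : ℕ) (_ : List ℕ) (acc : ℕ) => Nat.lor acc (Nat.shiftLeft E x)) [0, a, b]) acc) k) (Nat.shiftLeft acc c)) 64) 2)) (2 ^ 31676)) (2 ^ 31676 - 1) = true := by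
    apply rawAlive_of_testBit (t := 31676)
    intro r hr
    rcases hchainP r (by omega) with ⟨t, ht, hcard, hsum⟩ | ⟨t, ht, hcard, hsum⟩
    · rw [← hsum]
      exact Or.inl (testBit_incMask2_of_multiset [0, a, b] c 64 t ht hcard)
    · rw [← hsum]
      exact Or.inr (testBit_incMask2_of_multiset [0, a, b] c 64 t ht hcard)
  have hbit : ∀ r, r ≤ 31678 →
      r ∈ (Finset.univ : Finset (Sym (Fin 4) 64)).image (fun s : Sym (Fin 4) 64 => ((s : Multiset (Fin 4)).map d).sum) →
      Nat.beq (Nat.mod (Nat.div (@Nat.rec (fun _ => ℕ) 1 (fun (k acc : ℕ) => Nat.lor (@Nat.rec (fun _ => ℕ) ((fun (E : ℕ) => @List.rec ℕ (fun _ => ℕ) 0 (fun (x : ℕ) (_ : List ℕ) (acc : ℕ) => Nat.lor acc (Nat.shiftLeft E x)) [0, a, b]) 1) (fun (_ acc : ℕ) => (fun (E : ℕ) => @List.rec ℕ (fun _ => ℕ) 0 (fun (x : ℕ) (_ : List ℕ) (acc : ℕ) => Nat.lor acc (Nat.shiftLeft E x)) [0, a, b]) acc) k) (Nat.shiftLeft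 acc c)) 64) (2 ^ r)) 2) 1 = true := by
    intro r hr hr'
    obtain ⟨t, ht, hcard, hsum⟩ := hsumP r hr hr'
    rw [rawBit_eq_true_iff', ← hsum]
    exact testBit_incMask2_of_multiset [0, a, b] c 64 t ht hcard
  have peel : ∀ (Z LO HI LO' HI' : ℕ), Z = 1 → LO ≤ b → b < HI → LO' ≤ c → c < HI' →
      (@Nat.rec (fun _ => ℕ → Bool) (fun _ => true) (fun (_ : ℕ) (ih : ℕ → Bool) (a : ℕ) => cond ((Nat.ble (31676 + 2) a || Nat.beq (Nat.mod (Nat.div (Nat.lor (@Nat.rec (fun _ => ℕ) ((fun (E : ℕ) => @List.rec ℕ (fun _ => ℕ) 0 (fun (x : ℕ) (_ : List ℕ) (acc : ℕ) => Nat.lor acc (Nat.shiftLeft E x)) [0]) 1) (fun (_ acc : ℕ) => (fun (E : ℕ) => @List.rec ℕ (fun _ => ℕ) 0 (fun (x : ℕ) (_ : List ℕ) (acc : ℕ) => Nat.lor acc (Nat.shiftLeft E x)) [0]) acc) 63) (Nat.div (@Nat.rec (fun _ => ℕ) ((fun (E : ℕ) => @List.rec ℕ (fun _ => ℕ) 0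 (fun (x : ℕ) (_ : List ℕ) (acc : ℕ) => Nat.lor acc (Nat.shiftLeft E x)) [0]) 1) (fun (_ acc : ℕ) => (fun (E : ℕ) => @List.rec ℕ (fun _ => ℕ) 0 (fun (x : ℕ) (_ : List ℕ) (acc : ℕ) => Nat.lor acc (Nat.shiftLeft E x)) [0]) acc) 63) 2)) (Nat.pow 2 (a - 2))) 2) 1)) (((@Nat.rec (fun _ => ℕ → Bool) (fun _ => true) (fun (_ : ℕ) (ih : ℕ → Bool) (b : ℕ) => cond (Nat.beq (Nat.mod (Nat.lor (@Nat.rec (fun _ => ℕ) ((fun (E : ℕ) => @List.rec ℕ (fun _ => ℕ) 0 (fun (x : ℕ) (_ : List ℕ) (acc : ℕ) => Nat.lor acc (Nat.shiftLeft E x)) [0, a]) 1) (fun (_ acc : ℕ) => (fun (E : ℕ) => @List.rec ℕ (fun _ => ℕ) 0 (fun (x : ℕ) (_ : List ℕ) (acc : ℕ) => Nat.lor acc (Nat.shiftLeft E x)) [0, a]) acc) 63) (Nat.div (@Nat.rec (fun _ => ℕ) ((fun (E : ℕ) => @List.rec ℕ (fun _ => ℕ) 0 (fun (x : ℕ) (_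 : List ℕ) (acc : ℕ) => Nat.lor acc (Nat.shiftLeft E x)) [0, a]) 1) (fun (_ acc : ℕ) => (fun (E : ℕ) => @List.rec ℕ (fun _ => ℕ) 0 (fun (x : ℕ) (_ : List ℕ) (acc : ℕ) => Nat.lor acc (Nat.shiftLeft E x)) [0, a]) acc) 63) 2)) (2 ^ ((b - 1) - ((b - 1) - 31676)))) (2 ^ ((b - 1) - ((b - 1) - 31676)) - 1)) (((@Nat.rec (fun _ => ℕ → Bool) (fun _ => true) (fun (_ : ℕ) (ih : ℕ → Bool) (c : ℕ) => cond (Nat.beq (Nat.mod (Nat.lor (@Nat.rec (fun _ => ℕ) ((fun (E : ℕ) => @List.rec ℕ (fun _ => ℕ) 0 (fun (x : ℕ) (_ : List ℕ) (acc : ℕ) => Nat.lor acc (Nat.shiftLeft E x)) [0, a, b]) 1) (fun (_ acc : ℕ) => (fun (E : ℕ) => @List.rec ℕ (fun _ => ℕ) 0 (fun (x : ℕ) (_ : List ℕ) (acc : ℕ) => Nat.lor acc (Nat.shiftLeft E x)) [0, a, b]) acc) 63) (Nat.div (@Nat.rec (fun _ => ℕ) ((fun (E : ℕ) => @List.rec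 ℕ (fun _ => ℕ) 0 (fun (x : ℕ) (_ : List ℕ) (acc : ℕ) => Nat.lor acc (Nat.shiftLeft E x)) [0, a, b]) 1) (fun (_ acc : ℕ) => (fun (E : ℕ) => @List.rec ℕ (fun _ => ℕ) 0 (fun (x : ℕ) (_ : List ℕ) (acc : ℕ) => Nat.lor acc (Nat.shiftLeft E x)) [0, a, b]) acc) 63) 2)) (2 ^ ((c - 1) - ((c - 1) - 31676)))) (2 ^ ((c - 1) - ((c - 1) - 31676)) - 1)) (((!(Nat.beq (Nat.mod (Nat.lor (@Nat.rec (fun _ => ℕ) 1 (fun (k acc : ℕ) => Nat.lor (@Nat.rec (fun _ => ℕ) ((fun (E : ℕ) => @List.rec ℕ (fun _ => ℕ) 0 (fun (x : ℕ) (_ : List ℕ) (acc : ℕ) => Nat.lor acc (Nat.shiftLeft E x)) [0, a, b]) 1) (fun (_ acc : ℕ) => (fun (E : ℕ) => @List.rec ℕ (fun _ => ℕ) 0 (fun (x : ℕ) (_ : List ℕ) (acc : ℕ) => Nat.lor acc (Nat.shiftLeft E x)) [0, a, b]) acc) k) (Nat.shiftLeft acc c)) 64) (Nat.div (@Nat.rec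 (fun _ => ℕ) 1 (fun (k acc : ℕ) => Nat.lor (@Nat.rec (fun _ => ℕ) ((fun (E : ℕ) => @List.rec ℕ (fun _ => ℕ) 0 (fun (x : ℕ) (_ : List ℕ) (acc : ℕ) => Nat.lor acc (Nat.shiftLeft E x)) [0, a, b]) 1) (fun (_ acc : ℕ) => (fun (E : ℕ) => @List.rec ℕ (fun _ => ℕ) 0 (fun (x : ℕ) (_ : List ℕ) (acc : ℕ) => Nat.lor acc (Nat.shiftLeft E x)) [0, a, b]) acc) k) (Nat.shiftLeft acc c)) 64) 2)) (2 ^ 31676)) (2 ^ 31676 - 1)) || (!(Nat.beq (Nat.mod (Nat.div (@Nat.rec (fun _ => ℕ) 1 (fun (k acc : ℕ) => Nat.lor (@Nat.rec (fun _ => ℕ) ((fun (E : ℕ) => @List.rec ℕ (fun _ => ℕ) 0 (fun (x : ℕ) (_ : List ℕ) (acc : ℕ) => Nat.lor acc (Nat.shiftLeft E x)) [0, a, b]) 1) (fun (_ acc : ℕ) => (fun (E : ℕ) => @List.rec ℕ (fun _ => ℕ) 0 (fun (x : ℕ) (_ : List ℕ) (acc : ℕ) => Nat.lor acc (Nat.shiftLeft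 E x)) [0, a, b]) acc) k) (Nat.shiftLeft acc c)) 64) (2 ^ 31677)) 2) 1) && (!(Nat.beq (Nat.mod (Nat.div (@Nat.rec (fun _ => ℕ) 1 (fun (k acc : ℕ) => Nat.lor (@Nat.rec (fun _ => ℕ) ((fun (E : ℕ) => @List.rec ℕ (fun _ => ℕ) 0 (fun (x : ℕ) (_ : List ℕ) (acc : ℕ) => Nat.lor acc (Nat.shiftLeft E x)) [0, a, b]) 1) (fun (_ acc : ℕ) => (fun (E : ℕ) => @List.rec ℕ (fun _ => ℕ) 0 (fun (x : ℕ) (_ : List ℕ) (acc : ℕ) => Nat.lor acc (Nat.shiftLeft E x)) [0, a, b]) acc) k) (Nat.shiftLeft acc c)) 64) (2 ^ 31676)) 2) 1) || !(Nat.beq (Nat.mod (Nat.div (@Nat.rec (fun _ => ℕ) 1 (fun (k acc : ℕ) => Nat.lor (@Nat.rec (fun _ => ℕ) ((fun (E : ℕ) => @List.rec ℕ (fun _ => ℕ) 0 (fun (x : ℕ) (_ : List ℕ) (acc : ℕ) => Nat.lor acc (Nat.shiftLeft E x)) [0, a, b]) 1) (fun (_ acc : ℕ) => (fun (E : ℕ)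 => @List.rec ℕ (fun _ => ℕ) 0 (fun (x : ℕ) (_ : List ℕ) (acc : ℕ) => Nat.lor acc (Nat.shiftLeft E x)) [0, a, b]) acc) k) (Nat.shiftLeft acc c)) 64) (2 ^ 31678)) 2) 1))))) && ih (c + 1)) true) ((HI' - ((b + 1) + (LO' - (b + 1))))) (((b + 1) + (LO' - (b + 1)))))) && ih (b + 1)) true) ((HI - ((a + 1) + (LO - (a + 1))))) (((a + 1) + (LO - (a + 1)))))) && ih (a + 1)) true) (31680 - (Z)) (Z)) = true → False := by
    intro Z LO HI LO' HI' hZ hLO hHI hLO' hHI' W0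
    have W1 := walk_true (p := fun (a : ℕ) => (Nat.ble (31676 + 2) a || Nat.beq (Nat.mod (Nat.div (Nat.lor (@Nat.rec (fun _ => ℕ) ((fun (E : ℕ) => @List.rec ℕ (fun _ => ℕ) 0 (fun (x : ℕ) (_ : List ℕ) (acc : ℕ) => Nat.lor acc (Nat.shiftLeft E x)) [0]) 1) (fun (_ acc : ℕ) => (fun (E : ℕ) => @List.rec ℕ (fun _ => ℕ) 0 (fun (x : ℕ) (_ : List ℕ) (acc : ℕ) => Nat.lor acc (Nat.shiftLeft E x)) [0]) acc) 63) (Nat.div (@Nat.rec (fun _ => ℕ) ((fun (E : ℕ) => @List.rec ℕ (fun _ => ℕ) 0 (fun (x : ℕ) (_ : List ℕ) (acc : ℕ) => Nat.lor acc (Nat.shiftLeft E x)) [0]) 1) (fun (_ acc : ℕ) => (fun (E : ℕ) => @List.rec ℕ (fun _ => ℕ) 0 (fun (x : ℕ) (_ : List ℕ) (acc : ℕ) => Nat.lor acc (Nat.shiftLeft E x)) [0]) acc) 63) 2)) (Nat.pow 2 (a - 2))) 2) 1)) (q := fun (a : ℕ) => (@Nat.rec (fun _ => ℕ → Bool) (fun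 _ => true) (fun (_ : ℕ) (ih : ℕ → Bool) (b : ℕ) => cond (Nat.beq (Nat.mod (Nat.lor (@Nat.rec (fun _ => ℕ) ((fun (E : ℕ) => @List.rec ℕ (fun _ => ℕ) 0 (fun (x : ℕ) (_ : List ℕ) (acc : ℕ) => Nat.lor acc (Nat.shiftLeft E x)) [0, a]) 1) (fun (_ acc : ℕ) => (fun (E : ℕ) => @List.rec ℕ (fun _ => ℕ) 0 (fun (x : ℕ) (_ : List ℕ) (acc : ℕ) => Nat.lor acc (Nat.shiftLeft E x)) [0, a]) acc) 63) (Nat.div (@Nat.rec (fun _ => ℕ) ((fun (E : ℕ) => @List.rec ℕ (fun _ => ℕ) 0 (fun (x : ℕ) (_ : List ℕ) (acc : ℕ) => Nat.lor acc (Nat.shiftLeft E x)) [0, a]) 1) (fun (_ acc : ℕ) => (fun (E : ℕ) => @List.rec ℕ (fun _ => ℕ) 0 (fun (x : ℕ) (_ : List ℕ) (acc : ℕ) => Nat.lor acc (Nat.shiftLeft E x)) [0, a]) acc) 63) 2)) (2 ^ ((b - 1) - ((b - 1) - 31676)))) (2 ^ ((b - 1) - ((b - 1) - 31676)) - 1))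 (((@Nat.rec (fun _ => ℕ → Bool) (fun _ => true) (fun (_ : ℕ) (ih : ℕ → Bool) (c : ℕ) => cond (Nat.beq (Nat.mod (Nat.lor (@Nat.rec (fun _ => ℕ) ((fun (E : ℕ) => @List.rec ℕ (fun _ => ℕ) 0 (fun (x : ℕ) (_ : List ℕ) (acc : ℕ) => Nat.lor acc (Nat.shiftLeft E x)) [0, a, b]) 1) (fun (_ acc : ℕ) => (fun (E : ℕ) => @List.rec ℕ (fun _ => ℕ) 0 (fun (x : ℕ) (_ : List ℕ) (acc : ℕ) => Nat.lor acc (Nat.shiftLeft E x)) [0, a, b]) acc) 63) (Nat.div (@Nat.rec (fun _ => ℕ) ((fun (E : ℕ) => @List.rec ℕ (fun _ => ℕ) 0 (fun (x : ℕ) (_ : List ℕ) (acc : ℕ) => Nat.lor acc (Nat.shiftLeft E x)) [0, a, b]) 1) (fun (_ acc : ℕ) => (fun (E : ℕ) => @List.rec ℕ (fun _ => ℕ) 0 (fun (x : ℕ) (_ : List ℕ) (acc : ℕ) => Nat.lor acc (Nat.shiftLeft E x)) [0, a, b]) acc) 63) 2)) (2 ^ ((c - 1) - ((c - 1) - 31676))))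 (2 ^ ((c - 1) - ((c - 1) - 31676)) - 1)) (((!(Nat.beq (Nat.mod (Nat.lor (@Nat.rec (fun _ => ℕ) 1 (fun (k acc : ℕ) => Nat.lor (@Nat.rec (fun _ => ℕ) ((fun (E : ℕ) => @List.rec ℕ (fun _ => ℕ) 0 (fun (x : ℕ) (_ : List ℕ) (acc : ℕ) => Nat.lor acc (Nat.shiftLeft E x)) [0, a, b]) 1) (fun (_ acc : ℕ) => (fun (E : ℕ) => @List.rec ℕ (fun _ => ℕ) 0 (fun (x : ℕ) (_ : List ℕ) (acc : ℕ) => Nat.lor acc (Nat.shiftLeft E x)) [0, a, b]) acc) k) (Nat.shiftLeft acc c)) 64) (Nat.div (@Nat.rec (fun _ => ℕ) 1 (fun (k acc : ℕ) => Nat.lor (@Nat.rec (fun _ => ℕ) ((fun (E : ℕ) => @List.rec ℕ (fun _ => ℕ) 0 (fun (x : ℕ) (_ : List ℕ) (acc : ℕ) => Nat.lor acc (Nat.shiftLeft E x)) [0, a, b]) 1) (fun (_ acc : ℕ) => (fun (E : ℕ) => @List.rec ℕ (fun _ => ℕ) 0 (fun (x : ℕ) (_ : List ℕ) (acc : ℕ)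 => Nat.lor acc (Nat.shiftLeft E x)) [0, a, b]) acc) k) (Nat.shiftLeft acc c)) 64) 2)) (2 ^ 31676)) (2 ^ 31676 - 1)) || (!(Nat.beq (Nat.mod (Nat.div (@Nat.rec (fun _ => ℕ) 1 (fun (k acc : ℕ) => Nat.lor (@Nat.rec (fun _ => ℕ) ((fun (E : ℕ) => @List.rec ℕ (fun _ => ℕ) 0 (fun (x : ℕ) (_ : List ℕ) (acc : ℕ) => Nat.lor acc (Nat.shiftLeft E x)) [0, a, b]) 1) (fun (_ acc : ℕ) => (fun (E : ℕ) => @List.rec ℕ (fun _ => ℕ) 0 (fun (x : ℕ) (_ : List ℕ) (acc : ℕ) => Nat.lor acc (Nat.shiftLeft E x)) [0, a, b]) acc) k) (Nat.shiftLeft acc c)) 64) (2 ^ 31677)) 2) 1) && (!(Nat.beq (Nat.mod (Nat.div (@Nat.rec (fun _ => ℕ) 1 (fun (k acc : ℕ) => Nat.lor (@Nat.rec (fun _ => ℕ) ((fun (E : ℕ) => @List.rec ℕ (fun _ => ℕ) 0 (fun (x : ℕ) (_ : List ℕ) (acc : ℕ) => Nat.lor acc (Nat.shiftLeft E x)) [0,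 a, b]) 1) (fun (_ acc : ℕ) => (fun (E : ℕ) => @List.rec ℕ (fun _ => ℕ) 0 (fun (x : ℕ) (_ : List ℕ) (acc : ℕ) => Nat.lor acc (Nat.shiftLeft E x)) [0, a, b]) acc) k) (Nat.shiftLeft acc c)) 64) (2 ^ 31676)) 2) 1) || !(Nat.beq (Nat.mod (Nat.div (@Nat.rec (fun _ => ℕ) 1 (fun (k acc : ℕ) => Nat.lor (@Nat.rec (fun _ => ℕ) ((fun (E : ℕ) => @List.rec ℕ (fun _ => ℕ) 0 (fun (x : ℕ) (_ : List ℕ) (acc : ℕ) => Nat.lor acc (Nat.shiftLeft E x)) [0, a, b]) 1) (fun (_ acc : ℕ) => (fun (E : ℕ) => @List.rec ℕ (fun _ => ℕ) 0 (fun (x : ℕ) (_ : List ℕ) (acc : ℕ) => Nat.lor acc (Nat.shiftLeft E x)) [0, a, b]) acc) k) (Nat.shiftLeft acc c)) 64) (2 ^ 31678)) 2) 1))))) && ih (c + 1)) true) ((HI' - ((b + 1) + (LO' - (b + 1))))) (((b + 1) + (LO' - (b + 1)))))) && ih (b + 1)) true) ((HI - ((a + 1) + (LO - (a + 1))))) (((a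 + 1) + (LO - (a + 1)))))) (31680 - (Z)) (Z) a (by omega) (by omega) (fun c' h1 h2 => hg0 c' (by omega) h2) W0
    have W2 := walk_true (p := fun (b : ℕ) => Nat.beq (Nat.mod (Nat.lor (@Nat.rec (fun _ => ℕ) ((fun (E : ℕ) => @List.rec ℕ (fun _ => ℕ) 0 (fun (x : ℕ) (_ : List ℕ) (acc : ℕ) => Nat.lor acc (Nat.shiftLeft E x)) [0, a]) 1) (fun (_ acc : ℕ) => (fun (E : ℕ) => @List.rec ℕ (fun _ => ℕ) 0 (fun (x : ℕ) (_ : List ℕ) (acc : ℕ) => Nat.lor acc (Nat.shiftLeft E x)) [0, a]) acc) 63) (Nat.div (@Nat.rec (fun _ => ℕ) ((fun (E : ℕ) => @List.rec ℕ (fun _ => ℕ) 0 (fun (x : ℕ) (_ : List ℕ) (acc : ℕ) => Nat.lor acc (Nat.shiftLeft E x)) [0, a]) 1) (fun (_ acc : ℕ) => (fun (E : ℕ) => @List.rec ℕ (fun _ => ℕ) 0 (fun (x : ℕ) (_ : List ℕ) (acc : ℕ) => Nat.lor acc (Nat.shiftLeft E x)) [0, a]) acc) 63) 2)) (2 ^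 ((b - 1) - ((b - 1) - 31676)))) (2 ^ ((b - 1) - ((b - 1) - 31676)) - 1)) (q := fun (b : ℕ) => (@Nat.rec (fun _ => ℕ → Bool) (fun _ => true) (fun (_ : ℕ) (ih : ℕ → Bool) (c : ℕ) => cond (Nat.beq (Nat.mod (Nat.lor (@Nat.rec (fun _ => ℕ) ((fun (E : ℕ) => @List.rec ℕ (fun _ => ℕ) 0 (fun (x : ℕ) (_ : List ℕ) (acc : ℕ) => Nat.lor acc (Nat.shiftLeft E x)) [0, a, b]) 1) (fun (_ acc : ℕ) => (fun (E : ℕ) => @List.rec ℕ (fun _ => ℕ) 0 (fun (x : ℕ) (_ : List ℕ) (acc : ℕ) => Nat.lor acc (Nat.shiftLeft E x)) [0, a, b]) acc) 63) (Nat.div (@Nat.rec (fun _ => ℕ) ((fun (E : ℕ) => @List.rec ℕ (fun _ => ℕ) 0 (fun (x : ℕ) (_ : List ℕ) (acc : ℕ) => Nat.lor acc (Nat.shiftLeft E x)) [0, a, b]) 1) (fun (_ acc : ℕ) => (fun (E : ℕ) => @List.rec ℕ (fun _ => ℕ) 0 (fun (x : ℕ) (_ : List ℕ) (acc : ℕ)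 => Nat.lor acc (Nat.shiftLeft E x)) [0, a, b]) acc) 63) 2)) (2 ^ ((c - 1) - ((c - 1) - 31676)))) (2 ^ ((c - 1) - ((c - 1) - 31676)) - 1)) (((!(Nat.beq (Nat.mod (Nat.lor (@Nat.rec (fun _ => ℕ) 1 (fun (k acc : ℕ) => Nat.lor (@Nat.rec (fun _ => ℕ) ((fun (E : ℕ) => @List.rec ℕ (fun _ => ℕ) 0 (fun (x : ℕ) (_ : List ℕ) (acc : ℕ) => Nat.lor acc (Nat.shiftLeft E x)) [0, a, b]) 1) (fun (_ acc : ℕ) => (fun (E : ℕ) => @List.rec ℕ (fun _ => ℕ) 0 (fun (x : ℕ) (_ : List ℕ) (acc : ℕ) => Nat.lor acc (Nat.shiftLeft E x)) [0, a, b]) acc) k) (Nat.shiftLeft acc c)) 64) (Nat.div (@Nat.rec (fun _ => ℕ) 1 (fun (k acc : ℕ) => Nat.lor (@Nat.rec (fun _ => ℕ) ((fun (E : ℕ) => @List.rec ℕ (fun _ => ℕ) 0 (fun (x : ℕ) (_ : List ℕ) (acc : ℕ) => Nat.lor acc (Nat.shiftLeft E x)) [0, a, b]) 1) (fun (_ acc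 : ℕ) => (fun (E : ℕ) => @List.rec ℕ (fun _ => ℕ) 0 (fun (x : ℕ) (_ : List ℕ) (acc : ℕ) => Nat.lor acc (Nat.shiftLeft E x)) [0, a, b]) acc) k) (Nat.shiftLeft acc c)) 64) 2)) (2 ^ 31676)) (2 ^ 31676 - 1)) || (!(Nat.beq (Nat.mod (Nat.div (@Nat.rec (fun _ => ℕ) 1 (fun (k acc : ℕ) => Nat.lor (@Nat.rec (fun _ => ℕ) ((fun (E : ℕ) => @List.rec ℕ (fun _ => ℕ) 0 (fun (x : ℕ) (_ : List ℕ) (acc : ℕ) => Nat.lor acc (Nat.shiftLeft E x)) [0, a, b]) 1) (fun (_ acc : ℕ) => (fun (E : ℕ) => @List.rec ℕ (fun _ => ℕ) 0 (fun (x : ℕ) (_ : List ℕ) (acc : ℕ) => Nat.lor acc (Nat.shiftLeft E x)) [0, a, b]) acc) k) (Nat.shiftLeft acc c)) 64) (2 ^ 31677)) 2) 1) && (!(Nat.beq (Nat.mod (Nat.div (@Nat.rec (fun _ => ℕ) 1 (fun (k acc : ℕ) => Nat.lor (@Nat.rec (fun _ => ℕ) ((fun (E : ℕ) => @List.rec ℕ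 (fun _ => ℕ) 0 (fun (x : ℕ) (_ : List ℕ) (acc : ℕ) => Nat.lor acc (Nat.shiftLeft E x)) [0, a, b]) 1) (fun (_ acc : ℕ) => (fun (E : ℕ) => @List.rec ℕ (fun _ => ℕ) 0 (fun (x : ℕ) (_ : List ℕ) (acc : ℕ) => Nat.lor acc (Nat.shiftLeft E x)) [0, a, b]) acc) k) (Nat.shiftLeft acc c)) 64) (2 ^ 31676)) 2) 1) || !(Nat.beq (Nat.mod (Nat.div (@Nat.rec (fun _ => ℕ) 1 (fun (k acc : ℕ) => Nat.lor (@Nat.rec (fun _ => ℕ) ((fun (E : ℕ) => @List.rec ℕ (fun _ => ℕ) 0 (fun (x : ℕ) (_ : List ℕ) (acc : ℕ) => Nat.lor acc (Nat.shiftLeft E x)) [0, a, b]) 1) (fun (_ acc : ℕ) => (fun (E : ℕ) => @List.rec ℕ (fun _ => ℕ) 0 (fun (x : ℕ) (_ : List ℕ) (acc : ℕ) => Nat.lor acc (Nat.shiftLeft E x)) [0, a, b]) acc) k) (Nat.shiftLeft acc c)) 64) (2 ^ 31678)) 2) 1))))) && ih (c + 1)) true) ((HI' - ((b + 1) + (LO'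 - (b + 1))))) (((b + 1) + (LO' - (b + 1)))))) ((HI - ((a + 1) + (LO - (a + 1))))) (((a + 1) + (LO - (a + 1)))) b (by omega) (by omega) (fun c' h1 h2 => rawAlive_of_testBit (t := (c' - 1) - ((c' - 1) - 31676)) (fun r hr => halive1 r (by omega))) W1
    have W3 := walk_true (p := fun (c : ℕ) => Nat.beq (Nat.mod (Nat.lor (@Nat.rec (fun _ => ℕ) ((fun (E : ℕ) => @List.rec ℕ (fun _ => ℕ) 0 (fun (x : ℕ) (_ : List ℕ) (acc : ℕ) => Nat.lor acc (Nat.shiftLeft E x)) [0, a, b]) 1) (fun (_ acc : ℕ) => (fun (E : ℕ) => @List.rec ℕ (fun _ => ℕ) 0 (fun (x : ℕ) (_ : List ℕ) (acc : ℕ) => Nat.lor acc (Nat.shiftLeft E x)) [0, a, b]) acc) 63) (Nat.div (@Nat.rec (fun _ => ℕ) ((fun (E : ℕ) => @List.rec ℕ (fun _ => ℕ) 0 (fun (x : ℕ) (_ : List ℕ) (acc : ℕ) => Nat.lor acc (Nat.shiftLeft E x)) [0, a, b]) 1) (fun (_ acc : ℕ) => (fun (E : ℕ) => @List.rec ℕ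 (fun _ => ℕ) 0 (fun (x : ℕ) (_ : List ℕ) (acc : ℕ) => Nat.lor acc (Nat.shiftLeft E x)) [0, a, b]) acc) 63) 2)) (2 ^ ((c - 1) - ((c - 1) - 31676)))) (2 ^ ((c - 1) - ((c - 1) - 31676)) - 1)) (q := fun (c : ℕ) => (!(Nat.beq (Nat.mod (Nat.lor (@Nat.rec (fun _ => ℕ) 1 (fun (k acc : ℕ) => Nat.lor (@Nat.rec (fun _ => ℕ) ((fun (E : ℕ) => @List.rec ℕ (fun _ => ℕ) 0 (fun (x : ℕ) (_ : List ℕ) (acc : ℕ) => Nat.lor acc (Nat.shiftLeft E x)) [0, a, b]) 1) (fun (_ acc : ℕ) => (fun (E : ℕ) => @List.rec ℕ (fun _ => ℕ) 0 (fun (x : ℕ) (_ : List ℕ) (acc : ℕ) => Nat.lor acc (Nat.shiftLeft E x)) [0, a, b]) acc) k) (Nat.shiftLeft acc c)) 64) (Nat.div (@Nat.rec (fun _ => ℕ) 1 (fun (k acc : ℕ) => Nat.lor (@Nat.rec (fun _ => ℕ) ((fun (E : ℕ) => @List.rec ℕ (fun _ => ℕ) 0 (fun (x : ℕ) (_ :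 List ℕ) (acc : ℕ) => Nat.lor acc (Nat.shiftLeft E x)) [0, a, b]) 1) (fun (_ acc : ℕ) => (fun (E : ℕ) => @List.rec ℕ (fun _ => ℕ) 0 (fun (x : ℕ) (_ : List ℕ) (acc : ℕ) => Nat.lor acc (Nat.shiftLeft E x)) [0, a, b]) acc) k) (Nat.shiftLeft acc c)) 64) 2)) (2 ^ 31676)) (2 ^ 31676 - 1)) || (!(Nat.beq (Nat.mod (Nat.div (@Nat.rec (fun _ => ℕ) 1 (fun (k acc : ℕ) => Nat.lor (@Nat.rec (fun _ => ℕ) ((fun (E : ℕ) => @List.rec ℕ (fun _ => ℕ) 0 (fun (x : ℕ) (_ : List ℕ) (acc : ℕ) => Nat.lor acc (Nat.shiftLeft E x)) [0, a, b]) 1) (fun (_ acc : ℕ) => (fun (E : ℕ) => @List.rec ℕ (fun _ => ℕ) 0 (fun (x : ℕ) (_ : List ℕ) (acc : ℕ) => Nat.lor acc (Nat.shiftLeft E x)) [0, a, b]) acc) k) (Nat.shiftLeft acc c)) 64) (2 ^ 31677)) 2) 1) && (!(Nat.beq (Nat.mod (Nat.div (@Nat.rec (fun _ => ℕ) 1 (fun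 (k acc : ℕ) => Nat.lor (@Nat.rec (fun _ => ℕ) ((fun (E : ℕ) => @List.rec ℕ (fun _ => ℕ) 0 (fun (x : ℕ) (_ : List ℕ) (acc : ℕ) => Nat.lor acc (Nat.shiftLeft E x)) [0, a, b]) 1) (fun (_ acc : ℕ) => (fun (E : ℕ) => @List.rec ℕ (fun _ => ℕ) 0 (fun (x : ℕ) (_ : List ℕ) (acc : ℕ) => Nat.lor acc (Nat.shiftLeft E x)) [0, a, b]) acc) k) (Nat.shiftLeft acc c)) 64) (2 ^ 31676)) 2) 1) || !(Nat.beq (Nat.mod (Nat.div (@Nat.rec (fun _ => ℕ) 1 (fun (k acc : ℕ) => Nat.lor (@Nat.rec (fun _ => ℕ) ((fun (E : ℕ) => @List.rec ℕ (fun _ => ℕ) 0 (fun (x : ℕ) (_ : List ℕ) (acc : ℕ) => Nat.lor acc (Nat.shiftLeft E x)) [0, a, b]) 1) (fun (_ acc : ℕ) => (fun (E : ℕ) => @List.rec ℕ (fun _ => ℕ) 0 (fun (x : ℕ) (_ : List ℕ) (acc : ℕ) => Nat.lor acc (Nat.shiftLeft E x)) [0, a, b]) acc) k) (Nat.shiftLeft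 acc c)) 64) (2 ^ 31678)) 2) 1))))) ((HI' - ((b + 1) + (LO' - (b + 1))))) (((b + 1) + (LO' - (b + 1)))) c (by omega) (by omega) (fun c' h1 h2 => rawAlive_of_testBit (t := (c' - 1) - ((c' - 1) - 31676)) (fun r hr => halive2 r (by omega))) W2
    have WL : ((!(Nat.beq (Nat.mod (Nat.lor (@Nat.rec (fun _ => ℕ) 1 (fun (k acc : ℕ) => Nat.lor (@Nat.rec (fun _ => ℕ) ((fun (E : ℕ) => @List.rec ℕ (fun _ => ℕ) 0 (fun (x : ℕ) (_ : List ℕ) (acc : ℕ) => Nat.lor acc (Nat.shiftLeft E x)) [0, a, b]) 1) (fun (_ acc : ℕ) => (fun (E : ℕ) => @List.rec ℕ (fun _ => ℕ) 0 (fun (x : ℕ) (_ : List ℕ) (acc : ℕ) => Nat.lor acc (Nat.shiftLeft E x)) [0, a, b]) acc) k) (Nat.shiftLeft acc c)) 64) (Nat.div (@Nat.rec (fun _ => ℕ) 1 (fun (k acc : ℕ) => Nat.lor (@Nat.rec (fun _ => ℕ) ((fun (E : ℕ) => @List.rec ℕ (fun _ => ℕ) 0 (fun (x : ℕ) (_ :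 List ℕ) (acc : ℕ) => Nat.lor acc (Nat.shiftLeft E x)) [0, a, b]) 1) (fun (_ acc : ℕ) => (fun (E : ℕ) => @List.rec ℕ (fun _ => ℕ) 0 (fun (x : ℕ) (_ : List ℕ) (acc : ℕ) => Nat.lor acc (Nat.shiftLeft E x)) [0, a, b]) acc) k) (Nat.shiftLeft acc c)) 64) 2)) (2 ^ 31676)) (2 ^ 31676 - 1)) || (!(Nat.beq (Nat.mod (Nat.div (@Nat.rec (fun _ => ℕ) 1 (fun (k acc : ℕ) => Nat.lor (@Nat.rec (fun _ => ℕ) ((fun (E : ℕ) => @List.rec ℕ (fun _ => ℕ) 0 (fun (x : ℕ) (_ : List ℕ) (acc : ℕ) => Nat.lor acc (Nat.shiftLeft E x)) [0, a, b]) 1) (fun (_ acc : ℕ) => (fun (E : ℕ) => @List.rec ℕ (fun _ => ℕ) 0 (fun (x : ℕ) (_ : List ℕ) (acc : ℕ) => Nat.lor acc (Nat.shiftLeft E x)) [0, a, b]) acc) k) (Nat.shiftLeft acc c)) 64) (2 ^ 31677)) 2) 1) && (!(Nat.beq (Nat.mod (Nat.div (@Nat.rec (fun _ => ℕ) 1 (fun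 (k acc : ℕ) => Nat.lor (@Nat.rec (fun _ => ℕ) ((fun (E : ℕ) => @List.rec ℕ (fun _ => ℕ) 0 (fun (x : ℕ) (_ : List ℕ) (acc : ℕ) => Nat.lor acc (Nat.shiftLeft E x)) [0, a, b]) 1) (fun (_ acc : ℕ) => (fun (E : ℕ) => @List.rec ℕ (fun _ => ℕ) 0 (fun (x : ℕ) (_ : List ℕ) (acc : ℕ) => Nat.lor acc (Nat.shiftLeft E x)) [0, a, b]) acc) k) (Nat.shiftLeft acc c)) 64) (2 ^ 31676)) 2) 1) || !(Nat.beq (Nat.mod (Nat.div (@Nat.rec (fun _ => ℕ) 1 (fun (k acc : ℕ) => Nat.lor (@Nat.rec (fun _ => ℕ) ((fun (E : ℕ) => @List.rec ℕ (fun _ => ℕ) 0 (fun (x : ℕ) (_ : List ℕ) (acc : ℕ) => Nat.lor acc (Nat.shiftLeft E x)) [0, a, b]) 1) (fun (_ acc : ℕ) => (fun (E : ℕ) => @List.rec ℕ (fun _ => ℕ) 0 (fun (x : ℕ) (_ : List ℕ) (acc : ℕ) => Nat.lor acc (Nat.shiftLeft E x)) [0, a, b]) acc) k) (Nat.shiftLeft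 acc c)) 64) (2 ^ 31678)) 2) 1))))) = true := W3
    rw [hleafA] at WL
    simp only [Bool.not_true, Bool.false_or, Bool.and_eq_true, Bool.or_eq_true, Bool.not_eq_true'] at WL
    obtain ⟨hnoT1, hnoT0T2⟩ := WL
    have hcontra : ∀ r, r ≤ 31678 →
        r ∈ (Finset.univ : Finset (Sym (Fin 4) 64)).image (fun s : Sym (Fin 4) 64 => ((s : Multiset (Fin 4)).map d).sum) →
        Nat.beq (Nat.mod (Nat.div (@Nat.rec (fun _ => ℕ) 1 (fun (k acc : ℕ) => Nat.lor (@Nat.rec (fun _ => ℕ) ((fun (E : ℕ) => @List.rec ℕ (fun _ => ℕ) 0 (fun (x : ℕ) (_ : List ℕ) (acc : ℕ) => Nat.lor acc (Nat.shiftLeft E x)) [0, a, b]) 1) (fun (_ acc : ℕ) => (fun (E : ℕ) => @List.rec ℕ (fun _ => ℕ) 0 (fun (x : ℕ) (_ : List ℕ) (acc : ℕ) => Nat.lor acc (Nat.shiftLeft E x)) [0, a, b]) acc) k) (Nat.shiftLeft acc c)) 64) (2 ^ r)) 2) 1 = false → False := by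
      intro r hr h hf
      have hb := hbit r hr h
      rw [hf] at hb
      exact Bool.false_ne_true hb
    rcases Nat.lt_or_ge (pencil d S).det.natDegree 31679 with hsmall | hbig
    · interval_cases h : (pencil d S).det.natDegree
      · exact hcontra 31677 (by omega) htop0 hnoT1
      · rcases hchain0 31676 (by omega) with h' | h'
        · rcases hnoT0T2 with hf | hf
          · exact hcontra 31676 (by omega) h' hf
          · exact hcontra 31678 (by omega) htop0 hf
        · exact hcontra 31677 (by omega) h' hnoT1
    · rcases hchain0 31676 (by omega) with h1 | h1
      · rcases hchain0 31677 (by omega) with h2 | h2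
        · exact hcontra 31677 (by omega) h2 hnoT1
        · rcases hnoT0T2 with hf | hf
          · exact hcontra 31676 (by omega) h1 hf
          · exact hcontra 31678 (by omega) h2 hf
      · exact hcontra 31677 (by omega) h1 hnoT1
  rcases Nat.lt_or_ge b 24 with hlt_s | hge1
  · rcases Nat.lt_or_ge c 83 with hlt_t | hgi1
    · exact peel 1 0 24 0 83 rfl (Nat.zero_le _) hlt_s (Nat.zero_le _) hlt_t sectorWalk_sixtyfour_four_s2_0_24_s3_0_83
    · rcases Nat.lt_or_ge c 153 with hlt_t | hgi2
      · exact peel 1 0 24 83 153 rfl (Nat.zero_le _) hlt_s hgi1 hlt_t sectorWalk_sixtyfour_four_s2_0_24_s3_83_153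
      · rcases Nat.lt_or_ge c 225 with hlt_t | hgi3
        · exact peel 1 0 24 153 225 rfl (Nat.zero_le _) hlt_s hgi2 hlt_t sectorWalk_sixtyfour_four_s2_0_24_s3_153_225
        · rcases Nat.lt_or_ge c 302 with hlt_t | hgi4
          · exact peel 1 0 24 225 302 rfl (Nat.zero_le _) hlt_s hgi3 hlt_t sectorWalk_sixtyfour_four_s2_0_24_s3_225_302
          · rcases Nat.lt_or_ge c 384 with hlt_t | hgi5
            · exact peel 1 0 24 302 384 rfl (Nat.zero_le _) hlt_s hgi4 hlt_t sectorWalk_sixtyfour_four_s2_0_24_s3_302_384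
            · rcases Nat.lt_or_ge c 474 with hlt_t | hgi6
              · exact peel 1 0 24 384 474 rfl (Nat.zero_le _) hlt_s hgi5 hlt_t sectorWalk_sixtyfour_four_s2_0_24_s3_384_474
              · rcases Nat.lt_or_ge c 574 with hlt_t | hgi7
                · exact peel 1 0 24 474 574 rfl (Nat.zero_le _) hlt_s hgi6 hlt_t sectorWalk_sixtyfour_four_s2_0_24_s3_474_574
                · rcases Nat.lt_or_ge c 691 with hlt_t | hgi8
                  · exact peel 1 0 24 574 691 rfl (Nat.zero_le _) hlt_s hgi7 hlt_t sectorWalk_sixtyfour_four_s2_0_24_s3_574_691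
                  · rcases Nat.lt_or_ge c 840 with hlt_t | hgi9
                    · exact peel 1 0 24 691 840 rfl (Nat.zero_le _) hlt_s hgi8 hlt_t sectorWalk_sixtyfour_four_s2_0_24_s3_691_840
                    · rcases Nat.lt_or_ge c 1262 with hlt_t | hgi10
                      · exact peel 1 0 24 840 1262 rfl (Nat.zero_le _) hlt_s hgi9 hlt_t sectorWalk_sixtyfour_four_s2_0_24_s3_840_1262
                      · exact peel 1 0 24 1262 31680 rfl (Nat.zero_le _) hlt_s hgi10 (hltC c (by simp)) sectorWalk_sixtyfour_four_s2_0_24_s3_1262_31680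
  · rcases Nat.lt_or_ge b 35 with hlt_s | hge2
    · rcases Nat.lt_or_ge c 166 with hlt_t | hgi1
      · exact peel 1 24 35 0 166 rfl hge1 hlt_s (Nat.zero_le _) hlt_t sectorWalk_sixtyfour_four_s2_24_35_s3_0_166
      · rcases Nat.lt_or_ge c 302 with hlt_t | hgi2
        · exact peel 1 24 35 166 302 rfl hge1 hlt_s hgi1 hlt_t sectorWalk_sixtyfour_four_s2_24_35_s3_166_302
        · rcases Nat.lt_or_ge c 438 with hlt_t | hgi3
          · exact peel 1 24 35 302 438 rfl hge1 hlt_s hgi2 hlt_t sectorWalk_sixtyfour_four_s2_24_35_s3_302_438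
          · rcases Nat.lt_or_ge c 574 with hlt_t | hgi4
            · exact peel 1 24 35 438 574 rfl hge1 hlt_s hgi3 hlt_t sectorWalk_sixtyfour_four_s2_24_35_s3_438_574
            · rcases Nat.lt_or_ge c 710 with hlt_t | hgi5
              · exact peel 1 24 35 574 710 rfl hge1 hlt_s hgi4 hlt_t sectorWalk_sixtyfour_four_s2_24_35_s3_574_710
              · rcases Nat.lt_or_ge c 846 with hlt_t | hgi6
                · exact peel 1 24 35 710 846 rfl hge1 hlt_s hgi5 hlt_t sectorWalk_sixtyfour_four_s2_24_35_s3_710_846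
                · rcases Nat.lt_or_ge c 982 with hlt_t | hgi7
                  · exact peel 1 24 35 846 982 rfl hge1 hlt_s hgi6 hlt_t sectorWalk_sixtyfour_four_s2_24_35_s3_846_982
                  · rcases Nat.lt_or_ge c 1126 with hlt_t | hgi8
                    · exact peel 1 24 35 982 1126 rfl hge1 hlt_s hgi7 hlt_t sectorWalk_sixtyfour_four_s2_24_35_s3_982_1126
                    · rcases Nat.lt_or_ge c 1399 with hlt_t | hgi9
                      · exact peel 1 24 35 1126 1399 rfl hge1 hlt_s hgi8 hlt_t sectorWalk_sixtyfour_four_s2_24_35_s3_1126_1399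
                      · exact peel 1 24 35 1399 31680 rfl hge1 hlt_s hgi9 (hltC c (by simp)) sectorWalk_sixtyfour_four_s2_24_35_s3_1399_31680
    · rcases Nat.lt_or_ge b 45 with hlt_s | hge3
      · rcases Nat.lt_or_ge c 190 with hlt_t | hgi1
        · exact peel 1 35 45 0 190 rfl hge2 hlt_s (Nat.zero_le _) hlt_t sectorWalk_sixtyfour_four_s2_35_45_s3_0_190
        · rcases Nat.lt_or_ge c 340 with hlt_t | hgi2
          · exact peel 1 35 45 190 340 rfl hge2 hlt_s hgi1 hlt_t sectorWalk_sixtyfour_four_s2_35_45_s3_190_340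
          · rcases Nat.lt_or_ge c 490 with hlt_t | hgi3
            · exact peel 1 35 45 340 490 rfl hge2 hlt_s hgi2 hlt_t sectorWalk_sixtyfour_four_s2_35_45_s3_340_490
            · rcases Nat.lt_or_ge c 640 with hlt_t | hgi4
              · exact peel 1 35 45 490 640 rfl hge2 hlt_s hgi3 hlt_t sectorWalk_sixtyfour_four_s2_35_45_s3_490_640
              · rcases Nat.lt_or_ge c 790 with hlt_t | hgi5
                · exact peel 1 35 45 640 790 rfl hge2 hlt_s hgi4 hlt_t sectorWalk_sixtyfour_four_s2_35_45_s3_640_790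
                · rcases Nat.lt_or_ge c 940 with hlt_t | hgi6
                  · exact peel 1 35 45 790 940 rfl hge2 hlt_s hgi5 hlt_t sectorWalk_sixtyfour_four_s2_35_45_s3_790_940
                  · rcases Nat.lt_or_ge c 1092 with hlt_t | hgi7
                    · exact peel 1 35 45 940 1092 rfl hge2 hlt_s hgi6 hlt_t sectorWalk_sixtyfour_four_s2_35_45_s3_940_1092
                    · rcases Nat.lt_or_ge c 1361 with hlt_t | hgi8
                      · exact peel 1 35 45 1092 1361 rfl hge2 hlt_s hgi7 hlt_t sectorWalk_sixtyfour_four_s2_35_45_s3_1092_1361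
                      · rcases Nat.lt_or_ge c 1661 with hlt_t | hgi9
                        · exact peel 1 35 45 1361 1661 rfl hge2 hlt_s hgi8 hlt_t sectorWalk_sixtyfour_four_s2_35_45_s3_1361_1661
                        · exact peel 1 35 45 1661 31680 rfl hge2 hlt_s hgi9 (hltC c (by simp)) sectorWalk_sixtyfour_four_s2_35_45_s3_1661_31680
      · rcases Nat.lt_or_ge b 55 with hlt_s | hge4
        · rcases Nat.lt_or_ge c 200 with hlt_t | hgi1
          · exact peel 1 45 55 0 200 rfl hge3 hlt_s (Nat.zero_le _) hlt_t sectorWalk_sixtyfour_four_s2_45_55_s3_0_200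
          · rcases Nat.lt_or_ge c 350 with hlt_t | hgi2
            · exact peel 1 45 55 200 350 rfl hge3 hlt_s hgi1 hlt_t sectorWalk_sixtyfour_four_s2_45_55_s3_200_350
            · rcases Nat.lt_or_ge c 500 with hlt_t | hgi3
              · exact peel 1 45 55 350 500 rfl hge3 hlt_s hgi2 hlt_t sectorWalk_sixtyfour_four_s2_45_55_s3_350_500
              · rcases Nat.lt_or_ge c 650 with hlt_t | hgi4
                · exact peel 1 45 55 500 650 rfl hge3 hlt_s hgi3 hlt_t sectorWalk_sixtyfour_four_s2_45_55_s3_500_650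
                · rcases Nat.lt_or_ge c 802 with hlt_t | hgi5
                  · exact peel 1 45 55 650 802 rfl hge3 hlt_s hgi4 hlt_t sectorWalk_sixtyfour_four_s2_45_55_s3_650_802
                  · rcases Nat.lt_or_ge c 996 with hlt_t | hgi6
                    · exact peel 1 45 55 802 996 rfl hge3 hlt_s hgi5 hlt_t sectorWalk_sixtyfour_four_s2_45_55_s3_802_996
                    · rcases Nat.lt_or_ge c 1290 with hlt_t | hgi7
                      · exact peel 1 45 55 996 1290 rfl hge3 hlt_s hgi6 hlt_t sectorWalk_sixtyfour_four_s2_45_55_s3_996_1290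
                      · rcases Nat.lt_or_ge c 1590 with hlt_t | hgi8
                        · exact peel 1 45 55 1290 1590 rfl hge3 hlt_s hgi7 hlt_t sectorWalk_sixtyfour_four_s2_45_55_s3_1290_1590
                        · rcases Nat.lt_or_ge c 1890 with hlt_t | hgi9
                          · exact peel 1 45 55 1590 1890 rfl hge3 hlt_s hgi8 hlt_t sectorWalk_sixtyfour_four_s2_45_55_s3_1590_1890
                          · exact peel 1 45 55 1890 31680 rfl hge3 hlt_s hgi9 (hltC c (by simp)) sectorWalk_sixtyfour_four_s2_45_55_s3_1890_31680
        · rcases Nat.lt_or_ge b 66 with hlt_s | hge5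
          · rcases Nat.lt_or_ge c 197 with hlt_t | hgi1
            · exact peel 1 55 66 0 197 rfl hge4 hlt_s (Nat.zero_le _) hlt_t sectorWalk_sixtyfour_four_s2_55_66_s3_0_197
            · rcases Nat.lt_or_ge c 345 with hlt_t | hgi2
              · exact peel 1 55 66 197 345 rfl hge4 hlt_s hgi1 hlt_t sectorWalk_sixtyfour_four_s2_55_66_s3_197_345
              · rcases Nat.lt_or_ge c 517 with hlt_t | hgi3
                · exact peel 1 55 66 345 517 rfl hge4 hlt_s hgi2 hlt_t sectorWalk_sixtyfour_four_s2_55_66_s3_345_517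
                · rcases Nat.lt_or_ge c 740 with hlt_t | hgi4
                  · exact peel 1 55 66 517 740 rfl hge4 hlt_s hgi3 hlt_t sectorWalk_sixtyfour_four_s2_55_66_s3_517_740
                  · rcases Nat.lt_or_ge c 1012 with hlt_t | hgi5
                    · exact peel 1 55 66 740 1012 rfl hge4 hlt_s hgi4 hlt_t sectorWalk_sixtyfour_four_s2_55_66_s3_740_1012
                    · rcases Nat.lt_or_ge c 1284 with hlt_t | hgi6
                      · exact peel 1 55 66 1012 1284 rfl hge4 hlt_s hgi5 hlt_t sectorWalk_sixtyfour_four_s2_55_66_s3_1012_1284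
                      · rcases Nat.lt_or_ge c 1556 with hlt_t | hgi7
                        · exact peel 1 55 66 1284 1556 rfl hge4 hlt_s hgi6 hlt_t sectorWalk_sixtyfour_four_s2_55_66_s3_1284_1556
                        · rcases Nat.lt_or_ge c 1828 with hlt_t | hgi8
                          · exact peel 1 55 66 1556 1828 rfl hge4 hlt_s hgi7 hlt_t sectorWalk_sixtyfour_four_s2_55_66_s3_1556_1828
                          · rcases Nat.lt_or_ge c 2100 with hlt_t | hgi9
                            · exact peel 1 55 66 1828 2100 rfl hge4 hlt_s hgi8 hlt_t sectorWalk_sixtyfour_four_s2_55_66_s3_1828_2100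
                            · exact peel 1 55 66 2100 31680 rfl hge4 hlt_s hgi9 (hltC c (by simp)) sectorWalk_sixtyfour_four_s2_55_66_s3_2100_31680
          · rcases Nat.lt_or_ge b 80 with hlt_s | hge6
            · rcases Nat.lt_or_ge c 283 with hlt_t | hgi1
              · exact peel 1 66 80 0 283 rfl hge5 hlt_s (Nat.zero_le _) hlt_t sectorWalk_sixtyfour_four_s2_66_80_s3_0_283
              · rcases Nat.lt_or_ge c 497 with hlt_t | hgi2
                · exact peel 1 66 80 283 497 rfl hge5 hlt_s hgi1 hlt_t sectorWalk_sixtyfour_four_s2_66_80_s3_283_497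
                · rcases Nat.lt_or_ge c 711 with hlt_t | hgi3
                  · exact peel 1 66 80 497 711 rfl hge5 hlt_s hgi2 hlt_t sectorWalk_sixtyfour_four_s2_66_80_s3_497_711
                  · rcases Nat.lt_or_ge c 925 with hlt_t | hgi4
                    · exact peel 1 66 80 711 925 rfl hge5 hlt_s hgi3 hlt_t sectorWalk_sixtyfour_four_s2_66_80_s3_711_925
                    · rcases Nat.lt_or_ge c 1139 with hlt_t | hgi5
                      · exact peel 1 66 80 925 1139 rfl hge5 hlt_s hgi4 hlt_t sectorWalk_sixtyfour_four_s2_66_80_s3_925_1139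
                      · rcases Nat.lt_or_ge c 1353 with hlt_t | hgi6
                        · exact peel 1 66 80 1139 1353 rfl hge5 hlt_s hgi5 hlt_t sectorWalk_sixtyfour_four_s2_66_80_s3_1139_1353
                        · rcases Nat.lt_or_ge c 1567 with hlt_t | hgi7
                          · exact peel 1 66 80 1353 1567 rfl hge5 hlt_s hgi6 hlt_t sectorWalk_sixtyfour_four_s2_66_80_s3_1353_1567
                          · rcases Nat.lt_or_ge c 1781 with hlt_t | hgi8
                            · exact peel 1 66 80 1567 1781 rfl hge5 hlt_s hgi7 hlt_t sectorWalk_sixtyfour_four_s2_66_80_s3_1567_1781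
                            · rcases Nat.lt_or_ge c 1995 with hlt_t | hgi9
                              · exact peel 1 66 80 1781 1995 rfl hge5 hlt_s hgi8 hlt_t sectorWalk_sixtyfour_four_s2_66_80_s3_1781_1995
                              · exact peel 1 66 80 1995 31680 rfl hge5 hlt_s hgi9 (hltC c (by simp)) sectorWalk_sixtyfour_four_s2_66_80_s3_1995_31680
            · rcases Nat.lt_or_ge b 95 with hlt_s | hge7
              · rcases Nat.lt_or_ge c 288 with hlt_t | hgi1
                · exact peel 1 80 95 0 288 rfl hge6 hlt_s (Nat.zero_le _) hlt_t sectorWalk_sixtyfour_four_s2_80_95_s3_0_288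
                · rcases Nat.lt_or_ge c 488 with hlt_t | hgi2
                  · exact peel 1 80 95 288 488 rfl hge6 hlt_s hgi1 hlt_t sectorWalk_sixtyfour_four_s2_80_95_s3_288_488
                  · rcases Nat.lt_or_ge c 688 with hlt_t | hgi3
                    · exact peel 1 80 95 488 688 rfl hge6 hlt_s hgi2 hlt_t sectorWalk_sixtyfour_four_s2_80_95_s3_488_688
                    · rcases Nat.lt_or_ge c 888 with hlt_t | hgi4
                      · exact peel 1 80 95 688 888 rfl hge6 hlt_s hgi3 hlt_t sectorWalk_sixtyfour_four_s2_80_95_s3_688_888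
                      · rcases Nat.lt_or_ge c 1088 with hlt_t | hgi5
                        · exact peel 1 80 95 888 1088 rfl hge6 hlt_s hgi4 hlt_t sectorWalk_sixtyfour_four_s2_80_95_s3_888_1088
                        · rcases Nat.lt_or_ge c 1288 with hlt_t | hgi6
                          · exact peel 1 80 95 1088 1288 rfl hge6 hlt_s hgi5 hlt_t sectorWalk_sixtyfour_four_s2_80_95_s3_1088_1288
                          · rcases Nat.lt_or_ge c 1488 with hlt_t | hgi7
                            · exact peel 1 80 95 1288 1488 rfl hge6 hlt_s hgi6 hlt_t sectorWalk_sixtyfour_four_s2_80_95_s3_1288_1488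
                            · rcases Nat.lt_or_ge c 1688 with hlt_t | hgi8
                              · exact peel 1 80 95 1488 1688 rfl hge6 hlt_s hgi7 hlt_t sectorWalk_sixtyfour_four_s2_80_95_s3_1488_1688
                              · rcases Nat.lt_or_ge c 1890 with hlt_t | hgi9
                                · exact peel 1 80 95 1688 1890 rfl hge6 hlt_s hgi8 hlt_t sectorWalk_sixtyfour_four_s2_80_95_s3_1688_1890
                                · exact peel 1 80 95 1890 31680 rfl hge6 hlt_s hgi9 (hltC c (by simp)) sectorWalk_sixtyfour_four_s2_80_95_s3_1890_31680
              · rcases Nat.lt_or_ge b 117 with hlt_s | hge8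
                · rcases Nat.lt_or_ge c 242 with hlt_t | hgi1
                  · exact peel 1 95 117 0 242 rfl hge7 hlt_s (Nat.zero_le _) hlt_t sectorWalk_sixtyfour_four_s2_95_117_s3_0_242
                  · rcases Nat.lt_or_ge c 378 with hlt_t | hgi2
                    · exact peel 1 95 117 242 378 rfl hge7 hlt_s hgi1 hlt_t sectorWalk_sixtyfour_four_s2_95_117_s3_242_378
                    · rcases Nat.lt_or_ge c 514 with hlt_t | hgi3
                      · exact peel 1 95 117 378 514 rfl hge7 hlt_s hgi2 hlt_t sectorWalk_sixtyfour_four_s2_95_117_s3_378_514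
                      · rcases Nat.lt_or_ge c 650 with hlt_t | hgi4
                        · exact peel 1 95 117 514 650 rfl hge7 hlt_s hgi3 hlt_t sectorWalk_sixtyfour_four_s2_95_117_s3_514_650
                        · rcases Nat.lt_or_ge c 786 with hlt_t | hgi5
                          · exact peel 1 95 117 650 786 rfl hge7 hlt_s hgi4 hlt_t sectorWalk_sixtyfour_four_s2_95_117_s3_650_786
                          · rcases Nat.lt_or_ge c 922 with hlt_t | hgi6
                            · exact peel 1 95 117 786 922 rfl hge7 hlt_s hgi5 hlt_t sectorWalk_sixtyfour_four_s2_95_117_s3_786_922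
                            · rcases Nat.lt_or_ge c 1060 with hlt_t | hgi7
                              · exact peel 1 95 117 922 1060 rfl hge7 hlt_s hgi6 hlt_t sectorWalk_sixtyfour_four_s2_95_117_s3_922_1060
                              · rcases Nat.lt_or_ge c 1218 with hlt_t | hgi8
                                · exact peel 1 95 117 1060 1218 rfl hge7 hlt_s hgi7 hlt_t sectorWalk_sixtyfour_four_s2_95_117_s3_1060_1218
                                · rcases Nat.lt_or_ge c 1420 with hlt_t | hgi9
                                  · exact peel 1 95 117 1218 1420 rfl hge7 hlt_s hgi8 hlt_t sectorWalk_sixtyfour_four_s2_95_117_s3_1218_1420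
                                  · exact peel 1 95 117 1420 31680 rfl hge7 hlt_s hgi9 (hltC c (by simp)) sectorWalk_sixtyfour_four_s2_95_117_s3_1420_31680
                · rcases Nat.lt_or_ge c 352 with hlt_t | hgi1
                  · exact peel 1 117 31680 0 352 rfl hge8 (hltC b (by simp)) (Nat.zero_le _) hlt_t sectorWalk_sixtyfour_four_s2_117_31680_s3_0_352
                  · rcases Nat.lt_or_ge c 703 with hlt_t | hgi2
                    · exact peel 1 117 31680 352 703 rfl hge8 (hltC b (by simp)) hgi1 hlt_t sectorWalk_sixtyfour_four_s2_117_31680_s3_352_703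
                    · exact peel 1 117 31680 703 31680 rfl hge8 (hltC b (by simp)) hgi2 (hltC c (by simp)) sectorWalk_sixtyfour_four_s2_117_31680_s3_703_31680

end Summit.ValiantsHypothesis.ValiantsHypothesis.Theorems.LacunarySymmetroidMatrixDescartes.FiniteSector
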